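import Summits.QuantumFields.YangMills.Theorems.TwistedTraceScaling.Negative.TowerE1FalseWithoutBetaGuardsOfBase
import HarnessLib

/-!
# `TwistedTraceScaling` (crux stmt-QuantumFields-20203, route `LuscherReduction`, skeleton «twolattice» REV 3):
# negative-side support VII — guard facts for the ROUND-2 crux-idea re-cut «anchored-composition» (TowerCauchyE1 q ∧ PolyDeepTraceLaw p)
# (refuter crux-disprover seat, cycle 7; this file does NOT refute the crux or any stub)

HONEST FRAMING: `TwistedTraceScaling` is a femto-rung (R2b1) crux of a CONDITIONAL reduction route; nothing here is a mass-gap,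
infinite-volume or Clay statement.  Objects are the tree's (`TraceDoor.traceRatio/femtoSteps/hTraceRatio`, `InFemtoWindow`, `luscherLambda`,
`invRunningCoupling`).  The statement texts examined are those of the round-2 typed sketch `Cruxes/TwistedTraceScaling/SketchIdeator2g2.lean`
(`Ideate2g2.TowerCauchyE1 q`, `Ideate2g2.PolyDeepTraceLaw p`); they are SPELLED OUT INLINE below (no `Cruxes` import, no proposition defined
under `Summits/`), character for character up to the one binder each lemma deletes.

Results.
* §1 kit: `cells_le` (`2|E| + 4|P| ≤ 42N³` on `(ℤ/N)³`), `strong_side_ge_growing` — the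
  strong-coupling side bound `r(N, β₁, T) ≥ 1 − g/4` of support V (`TowerE1.strong_side_ge`, fixed `N`) extended to lattices GROWING like
  `N ≤ C·lam^{−q}` (the superexponentially small strong root `β₁ ≤ 2b₀e^{−(b₀/b₁)(1/lam³ − 1/2)}` beats `c_N·T ≲ N⁴/lam`), `anchor_threshold`
  (`(C·lam^{−q})^p ≤ 1/(4lam³)` for `pq < 3`, small `lam`; the ideator's lemma, re-proved here), `anchor_geometry` (the E1 pair
  `(L, b, k, j, L₁) = (M^{n+2}, M, n, n, M^{n+1})` with `M^{n+1}` the first power `≥ lam^{−q}`, so `L₁ ≤ M·lam^{−q}`, `L ≤ M²·lam^{−q}`).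
* §2 `polyDeep_false_without_floor`: the text of `PolyDeepTraceLaw p` with its depth floor `(L:ℝ)^p ≤ β →` deleted (the result no longer
  mentions `p`) is FALSE — witness `s = 1`, `ε = (1 − r_𝔥(1))/4`, `L = 1`, the STRONG root `0 < β < 1` of the label value `1/lam³`
  (`invRunningCoupling β 1 = 1/lam³ > 0`, `Λ(β,1) = lam ≤ Λ⋆`), where `r ≥ 1 − ε` while `r_𝔥(1) = 1 − 4ε`.  Moral: at `L = 1` the floor IS the
  `1 ≤ β` guard of support III (p532410); the positivity guard `0 < invRunningCoupling β L` alone does not select the weak branch.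
* §3 `towerCauchyE1_false_without_beta1GeOne_of_polyDeep` (`0 ≤ q`, `0 ≤ p`, `pq < 3`): PolyDeepTraceLaw p → ¬ (TowerCauchyE1 q with the
  binder `1 ≤ β₁ →` deleted) — strong root on the ANCHOR `L₁ = M^{n+1} ≥ lam^{−q}`, weak (window) root on the fine lattice `L = M^{n+2}`, which
  at window depth is itself poly-deep (`L^p ≤ (M²lam^{−q})^p ≤ 1/(4lam³) ≤ β`), so π pins its ratio near `r_𝔥(1)`.
* §4 `towerCauchyE1_false_without_windowBetaGeOne_of_polyDeep`: PolyDeepTraceLaw p → ¬ (TowerCauchyE1 q with `InFemtoWindow lam β L`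
  weakened to its two `Λ`-inequalities) — strong root on the fine lattice, weak window root `β₁ ≥ 1` on the anchor, pinned by π.
Moral of §3–§4: exactly as for TOWER-E1 (support V, modulo S-BASE), any proof of TowerCauchyE1 must use `1 ≤ β₁` AND the window's `1 ≤ β`;
the growing anchor does not change this, and the natural modulus is the line's own second stub π (S-BASE cannot serve: both lattices grow).
Ordinary negative / design lemmas; no verdict on S-BASE, π or TowerCauchyE1 themselves (OPEN; the sketch proves
`TowerCauchyE1 q ∧ PolyDeepTraceLaw p ⟺ UFTL ∧ S-BASE ⟺ CMP-2LOOP ∧ S-BASE` for `pq < 3`, i.e. the re-cut is strength-neutral modulo S-BASE).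
-/

set_option autoImplicit false

noncomputable section

open MeasureTheory Filter Topology Real
open Literature.MathematicalPhysics.QuantumFieldTheory hiding SU2
open Literature.MathematicalPhysics.QuantumLattice
open scoped BigOperators

namespace Summit.QuantumFields.YangMills.Theorems.TwistedTraceScaling.Negative

open Summit.QuantumFields.YangMills.Theorems.FemtoTransferGap
open Summit.QuantumFields.YangMills.Theorems.FemtoTransferGap.TraceDoor
open Summit.QuantumFields.YangMills.Theorems.FemtoTransferGap.TT
open Summit.QuantumFields.YangMills.Theorems.FemtoTransferGap.TwoLattice

namespace R7

/-! ## §1 Kit: cell counts, the strong side on growing lattices, the anchor threshold and the anchored E1 geometry -/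

/-- Cell counts of the periodic lattice `(ℤ/N)³`: `|E| = 3N³` and `|P| ≤ 9N³`, so `2|E| + 4|P| ≤ 42N³`. [folklore] -/
theorem cells_le (N : ℕ) [NeZero N] :
    2 * (Fintype.card (Edge 3 N) : ℝ) + 4 * (Fintype.card (Plaquette 3 N) : ℝ) ≤ 42 * (N : ℝ) ^ 3 := by
  have hS : Fintype.card (Site 3 N) = N ^ 3 := by
    simp [Fintype.card_pi, ZMod.card, Finset.prod_const, Finset.card_univ, Fintype.card_fin]
  have hE : Fintype.card (Edge 3 N) = N ^ 3 * 3 := by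
    rw [show Fintype.card (Edge 3 N) = Fintype.card (Site 3 N) * Fintype.card (Fin 3) from Fintype.card_prod _ _, hS,
      Fintype.card_fin]
  have hP : Fintype.card (Plaquette 3 N) ≤ N ^ 3 * 9 := by
    rw [show Fintype.card (Plaquette 3 N) = Fintype.card (Site 3 N) * Fintype.card {p : Fin 3 × Fin 3 // p.1 < p.2} from
      Fintype.card_prod _ _, hS]
    have h2 : Fintype.card {p : Fin 3 × Fin 3 // p.1 < p.2} ≤ 9 :=
      (Fintype.card_subtype_le _).trans (by simp [Fintype.card_prod, Fintype.card_fin])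
    exact Nat.mul_le_mul_left _ h2
  have hE' : (Fintype.card (Edge 3 N) : ℝ) = (N : ℝ) ^ 3 * 3 := by exact_mod_cast hE
  have hP' : (Fintype.card (Plaquette 3 N) : ℝ) ≤ (N : ℝ) ^ 3 * 9 := by exact_mod_cast hP
  have hN3 : (0 : ℝ) ≤ (N : ℝ) ^ 3 := by positivity
  rw [hE']
  linarith

/-- **Strong-side bound on GROWING lattices.**  For real `q`, `C ≥ 1`, `g > 0` there is `lam1 > 0` such that for `0 < lam ≤ lam1`, every lattice
`N ≤ C·lam^{−q}`, every coupling `0 ≤ β₁ ≤ 2b₀e^{−(b₀/b₁)(1/lam³ − 1/2)}` and every step count `1 ≤ T ≤ (N+1)/lam` give `traceRatio N β₁ T ≥ 1 − g/4`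
(`1 − 4c_Nβ₁T ≤ r`, `c_N ≤ 42N³`, `N ≤ C·lam^{−⌈q⌉}`, `e^{−κ/lam³} ≤ n!lam^{3n}/κⁿ` with `n = 2⌈q⌉+1`).  Extends `TowerE1.strong_side_ge` (fixed `N`). [folklore] -/
theorem strong_side_ge_growing {q C g : ℝ} (hC : 1 ≤ C) (hg : 0 < g) :
    ∃ lam1 : ℝ, 0 < lam1 ∧ lam1 ≤ 1 / 4 ∧ ∀ lam : ℝ, 0 < lam → lam ≤ lam1 →
      ∀ (N : ℕ) [NeZero N], (N : ℝ) ≤ C * lam ^ (-q) →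
        ∀ β₁ : ℝ, 0 ≤ β₁ → β₁ ≤ 2 * b0 * Real.exp (-(b0 / b1) * (1 / lam ^ 3 - 1 / 2)) →
          ∀ T : ℕ, 1 ≤ T → (T : ℝ) ≤ ((N : ℝ) + 1) / lam → 1 - g / 4 ≤ traceRatio N β₁ T := by
  have hb0 : 0 < b0 := by unfold b0; positivity
  have hb1 : 0 < b1 := by unfold b1; positivity
  have hC0 : 0 < C := by linarith
  obtain ⟨κ, hκ⟩ : ∃ κ : ℝ, κ = b0 / b1 := ⟨_, rfl⟩
  have hκ0 : 0 < κ := by rw [hκ]; exact div_pos hb0 hb1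
  obtain ⟨m, hm⟩ : ∃ m : ℕ, m = ⌈q⌉₊ := ⟨_, rfl⟩
  have hqm : q ≤ m := by rw [hm]; exact Nat.le_ceil q
  obtain ⟨n, hn⟩ : ∃ n : ℕ, n = 2 * m + 1 := ⟨_, rfl⟩
  obtain ⟨K, hK⟩ : ∃ K : ℝ, K = 2 * b0 * Real.exp (κ / 2) * ((n.factorial : ℝ) / κ ^ n) := ⟨_, rfl⟩
  have hK0 : 0 < K := by rw [hK]; positivity
  obtain ⟨D, hD⟩ : ∃ D : ℝ, D = 336 * C ^ 4 * K := ⟨_, rfl⟩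
  have hD0 : 0 < D := by rw [hD]; positivity
  refine ⟨min (1 / 4) (g / (4 * D)), lt_min (by norm_num) (by positivity), min_le_left _ _, ?_⟩
  intro lam hlam hlam_le N _ hN β₁ hβ₁0 hβ₁le T hT1 hTle
  have hlam_q : lam ≤ 1 / 4 := hlam_le.trans (min_le_left _ _)
  have hlam_g : lam ≤ g / (4 * D) := hlam_le.trans (min_le_right _ _)
  have hlam1 : lam ≤ 1 := by linarith
  have hlam0 : lam ≠ 0 := hlam.ne'
  -- the anchor bound coarsened to an integer power: `N ≤ C / lam^m`
  obtain ⟨P, hP⟩ : ∃ P : ℝ, P = lam ^ m := ⟨_, rfl⟩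
  have hP0 : 0 < P := by rw [hP]; positivity
  have hP1 : P ≤ 1 := by rw [hP]; exact pow_le_one₀ hlam.le hlam1
  have hA : lam ^ (-q) ≤ P⁻¹ := by
    have h1 : lam ^ (-q) ≤ lam ^ (-(m : ℝ)) := Real.rpow_le_rpow_of_exponent_ge hlam hlam1 (by linarith)
    rw [Real.rpow_neg hlam.le (m : ℝ), Real.rpow_natCast, ← hP] at h1
    exact h1
  have hNP : (N : ℝ) ≤ C / P := by
    calc (N : ℝ) ≤ C * lam ^ (-q) := hN
      _ ≤ C * P⁻¹ := mul_le_mul_of_nonneg_left hA hC0.le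
      _ = C / P := by rw [div_eq_mul_inv]
  have hN0 : (0 : ℝ) ≤ (N : ℝ) := Nat.cast_nonneg N
  have hCP1 : 1 ≤ C / P := by
    rw [le_div_iff₀ hP0]
    nlinarith
  have hN1 : (N : ℝ) + 1 ≤ 2 * C / P := by
    have : 2 * C / P = C / P + C / P := by ring
    linarith
  -- cell count, step count, coupling
  obtain ⟨c, hcdef⟩ : ∃ c : ℝ, c = 2 * (Fintype.card (Edge 3 N) : ℝ) + 4 * (Fintype.card (Plaquette 3 N) : ℝ) := ⟨_, rfl⟩
  have hcnn : 0 ≤ c := by rw [hcdef]; positivity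
  have hcle : c ≤ 42 * (C / P) ^ 3 := by
    calc c ≤ 42 * (N : ℝ) ^ 3 := by rw [hcdef]; exact cells_le N
      _ ≤ 42 * (C / P) ^ 3 := by gcongr
  have hT0 : (0 : ℝ) ≤ (T : ℝ) := Nat.cast_nonneg T
  have hTle' : (T : ℝ) ≤ 2 * C / P / lam :=
    hTle.trans (div_le_div_of_nonneg_right hN1 hlam.le)
  have he : Real.exp (-(b0 / b1) * (1 / lam ^ 3 - 1 / 2)) = Real.exp (κ / 2) * Real.exp (-(κ / lam ^ 3)) := by
    rw [← Real.exp_add, hκ]; congr 1; ring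
  have hx : 0 < κ / lam ^ 3 := by positivity
  have hex : Real.exp (-(κ / lam ^ 3)) ≤ (n.factorial : ℝ) / (κ / lam ^ 3) ^ n := by
    -- `e^{−x} ≤ n!/xⁿ` (`xⁿ/n! ≤ eˣ`; cf. `Literature.NumberTheory.Sieve.Iwaniec1980b.exp_neg_le_factorial_div_pow`, not imported here)
    have h := Real.pow_div_factorial_le_exp (x := κ / lam ^ 3) hx.le n
    have hfac : (0 : ℝ) < (n.factorial : ℝ) := by positivity
    have h1 : (κ / lam ^ 3) ^ n ≤ Real.exp (κ / lam ^ 3) * (n.factorial : ℝ) := (div_le_iff₀ hfac).mp h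
    rw [Real.exp_neg, inv_eq_one_div, div_le_div_iff₀ (Real.exp_pos _) (pow_pos hx n)]
    linarith
  have hex' : (n.factorial : ℝ) / (κ / lam ^ 3) ^ n = ((n.factorial : ℝ) / κ ^ n) * (lam ^ 3) ^ n := by
    rw [div_pow]
    field_simp
  have hβK : β₁ ≤ K * (lam ^ 3) ^ n := by
    calc β₁ ≤ 2 * b0 * Real.exp (-(b0 / b1) * (1 / lam ^ 3 - 1 / 2)) := hβ₁le
      _ = 2 * b0 * Real.exp (κ / 2) * Real.exp (-(κ / lam ^ 3)) := by rw [he]; ring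
      _ ≤ 2 * b0 * Real.exp (κ / 2) * (((n.factorial : ℝ) / κ ^ n) * (lam ^ 3) ^ n) := by
          rw [← hex']; exact mul_le_mul_of_nonneg_left hex (by positivity)
      _ = K * (lam ^ 3) ^ n := by rw [hK]; ring
  have hlow := one_sub_le_traceRatio N hβ₁0 hT1
  rw [← hcdef] at hlow
  have hsmall : 4 * (c * β₁) * T ≤ g / 4 := by
    calc 4 * (c * β₁) * T ≤ 4 * ((42 * (C / P) ^ 3) * (K * (lam ^ 3) ^ n)) * (2 * C / P / lam) := by
          apply mul_le_mul _ hTle' hT0 (by positivity)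
          apply mul_le_mul_of_nonneg_left _ (by norm_num : (0 : ℝ) ≤ 4)
          exact mul_le_mul hcle hβK hβ₁0 (by positivity)
      _ = D * lam ^ (2 * m + 2) := by
          rw [hD, hP, hn]
          field_simp
          ring
      _ ≤ D * lam := by
          apply mul_le_mul_of_nonneg_left _ hD0.le
          calc lam ^ (2 * m + 2) ≤ lam ^ 1 := pow_le_pow_of_le_one hlam.le hlam1 (by omega)
            _ = lam := pow_one lam
      _ ≤ D * (g / (4 * D)) := mul_le_mul_of_nonneg_left hlam_g hD0.le
      _ = g / 4 := by field_simp
  linarith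

/-- **Depth threshold of the anchor** (the ideator's `Ideate2g2.anchor_threshold`, re-proved here so that no `Cruxes` module is imported):
for `p·q < 3` and `C ≥ 1` there is `lamA > 0` with `(C·lam^{−q})^p ≤ 1/(4lam³)` for all `0 < lam ≤ lamA`. [folklore] -/
theorem anchor_threshold {p q : ℝ} (hpq : p * q < 3) {C : ℝ} (hC : 1 ≤ C) :
    ∃ lamA : ℝ, 0 < lamA ∧ ∀ lam : ℝ, 0 < lam → lam ≤ lamA → (C * lam ^ (-q)) ^ p ≤ 1 / (4 * lam ^ 3) := by
  have hC0 : 0 < C := lt_of_lt_of_le one_pos hC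
  have hCp : 0 < C ^ p := Real.rpow_pos_of_pos hC0 p
  obtain ⟨r, hr⟩ : ∃ r : ℝ, r = 3 - p * q := ⟨_, rfl⟩
  have hrpos : 0 < r := by rw [hr]; linarith
  obtain ⟨D, hD⟩ : ∃ D : ℝ, D = 1 / (4 * C ^ p) := ⟨_, rfl⟩
  have hDpos : 0 < D := by rw [hD]; positivity
  refine ⟨D ^ r⁻¹, Real.rpow_pos_of_pos hDpos _, fun lam hlam hle => ?_⟩
  have h1 : lam ^ r ≤ D := by
    calc lam ^ r ≤ (D ^ r⁻¹) ^ r := Real.rpow_le_rpow hlam.le hle hrpos.le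
      _ = D := Real.rpow_inv_rpow hDpos.le hrpos.ne'
  have hlq : 0 ≤ lam ^ (-q) := Real.rpow_nonneg hlam.le _
  have hL : (C * lam ^ (-q)) ^ p = C ^ p * lam ^ (-q * p) := by
    rw [Real.mul_rpow hC0.le hlq, ← Real.rpow_mul hlam.le]
  rw [hL, le_div_iff₀ (by positivity)]
  have h3 : (lam ^ 3 : ℝ) = lam ^ (3 : ℝ) := by
    rw [← Real.rpow_natCast lam 3]
    norm_num
  have hprod : lam ^ (-q * p) * lam ^ (3 : ℝ) = lam ^ r := by
    rw [← Real.rpow_add hlam, hr]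
    ring_nf
  calc C ^ p * lam ^ (-q * p) * (4 * lam ^ 3)
      = 4 * C ^ p * (lam ^ (-q * p) * lam ^ (3 : ℝ)) := by rw [h3]; ring
    _ = 4 * C ^ p * lam ^ r := by rw [hprod]
    _ ≤ 4 * C ^ p * D := mul_le_mul_of_nonneg_left h1 (by positivity)
    _ = 1 := by rw [hD]; field_simp

/-- **Anchored E1 geometry.**  For `M ≥ 2` and an anchor size `A ≥ 1` let `M^{n+1}` be the least power of `M` (exponent `≥ 1`) with
`A ≤ M^{n+1}`; then `M^{n+1} ≤ M·A`, `M^{n+2} ≤ M²·A`, and `(L, b, k, j, L₁) = (M^{n+2}, M, n, n, M^{n+1})` meets every E1 binder of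
TowerCauchyE1: `M² ≤ L`, `M ≤ b < M²`, `b·M^{k+1} ≤ L < b·M^k·(M+1)`, `L₁ = b·M^j`. [folklore] -/
theorem anchor_geometry (M : ℕ) (hM : 2 ≤ M) {A : ℝ} (hA1 : 1 ≤ A) :
    ∃ n : ℕ, A ≤ ((M ^ (n + 1) : ℕ) : ℝ) ∧ ((M ^ (n + 1) : ℕ) : ℝ) ≤ (M : ℝ) * A ∧ ((M ^ (n + 2) : ℕ) : ℝ) ≤ (M : ℝ) ^ 2 * A ∧
      M ^ 2 ≤ M ^ (n + 2) ∧ M ≤ M ∧ M < M ^ 2 ∧ M * M ^ (n + 1) ≤ M ^ (n + 2) ∧ M ^ (n + 2) < M * M ^ n * (M + 1) ∧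
      M ^ (n + 1) = M * M ^ n := by
  classical
  have hM1 : (1 : ℝ) < (M : ℝ) := by exact_mod_cast (lt_of_lt_of_le one_lt_two hM)
  have hM0 : (0 : ℝ) ≤ (M : ℝ) := Nat.cast_nonneg M
  have hex : ∃ n : ℕ, A ≤ (M : ℝ) ^ (n + 1) := by
    obtain ⟨n, hn⟩ := pow_unbounded_of_one_lt A hM1
    exact ⟨n, hn.le.trans (pow_le_pow_right₀ hM1.le (Nat.le_succ n))⟩
  have hspec : A ≤ (M : ℝ) ^ (Nat.find hex + 1) := Nat.find_spec hex
  have hle : (M : ℝ) ^ (Nat.find hex + 1) ≤ (M : ℝ) * A := by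
    rcases Nat.eq_zero_or_pos (Nat.find hex) with h0 | hpos
    · rw [h0, zero_add, pow_one]
      nlinarith
    · have hlt := Nat.find_min hex (m := Nat.find hex - 1) (by omega)
      rw [not_le, show Nat.find hex - 1 + 1 = Nat.find hex by omega] at hlt
      calc (M : ℝ) ^ (Nat.find hex + 1) = (M : ℝ) * (M : ℝ) ^ Nat.find hex := by ring
        _ ≤ (M : ℝ) * A := mul_le_mul_of_nonneg_left hlt.le hM0
  have hMpos : 0 < M := by omega
  have hMn : 0 < M ^ Nat.find hex := pow_pos hMpos _
  refine ⟨Nat.find hex, by push_cast; exact hspec, by push_cast; exact hle, ?_, ?_, le_rfl, by nlinarith, le_of_eq (by ring), ?_, by ring⟩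
  · push_cast
    calc (M : ℝ) ^ (Nat.find hex + 2) = (M : ℝ) * (M : ℝ) ^ (Nat.find hex + 1) := by ring
      _ ≤ (M : ℝ) * ((M : ℝ) * A) := mul_le_mul_of_nonneg_left hle hM0
      _ = (M : ℝ) ^ 2 * A := by ring
  · exact pow_le_pow_right₀ (by omega) (by omega)
  · have h1 : M ^ (Nat.find hex + 2) = M ^ Nat.find hex * M * M := by rw [pow_succ, pow_succ]
    rw [h1]
    nlinarith

/-! ## §2 PolyDeepTraceLaw: the depth floor `L^p ≤ β` is load-bearing (at `L = 1` it is the `1 ≤ β` guard) -/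

/-- **PolyDeepTraceLaw without its floor is false.**  Negated statement = the text of `Ideate2g2.PolyDeepTraceLaw p` with the binder
`(L : ℝ) ^ p ≤ β →` deleted (so `p` no longer occurs).  Witness: `s = 1`, `ε = (1 − r_𝔥(1))/4`, `L = 1`, a small depth `lam ≤ Λ⋆` and the
STRONG root `0 < β < 1` of the label value `1/lam³` on the one-link lattice (`TowerE1.strong_root 1`): the label is positive, `Λ(β,1) = lam`,
and `r(1, β, ⌈1/lam⌉) ≥ 1 − ε` (`TowerE1.strong_side_ge 1`) while `r_𝔥(1) = 1 − 4ε`. [folklore] -/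
theorem polyDeep_false_without_floor :
    ¬ (∀ s : ℝ, 0 < s → ∀ ε : ℝ, 0 < ε → ∃ Λstar : ℝ, 0 < Λstar ∧
        ∀ (L : ℕ) [NeZero L], ∀ β : ℝ, 0 < invRunningCoupling β L → luscherLambda β L ≤ Λstar →
          |traceRatio L β (femtoSteps s β L) - hTraceRatio s| ≤ ε) := by
  intro h
  have hr1 : hTraceRatio 1 < 1 := hTraceRatio_lt_one one_pos
  obtain ⟨g, hg⟩ : ∃ g : ℝ, g = 1 - hTraceRatio 1 := ⟨_, rfl⟩
  have hg0 : 0 < g := by rw [hg]; linarith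
  obtain ⟨Λstar, hΛstar, HP⟩ := h 1 one_pos (g / 4) (by positivity)
  obtain ⟨lam1, hlam1, hlam1q, HS⟩ := TowerE1.strong_side_ge 1 hg0
  obtain ⟨lam, hlam, hleΛ, hle1⟩ : ∃ lam : ℝ, 0 < lam ∧ lam ≤ Λstar ∧ lam ≤ lam1 :=
    ⟨min Λstar lam1, lt_min hΛstar hlam1, min_le_left _ _, min_le_right _ _⟩
  have hlam_half : lam ≤ 1 / 2 := by linarith [hle1.trans hlam1q]
  have hlam_one : lam ≤ 1 := by linarith
  obtain ⟨β, hβ0, -, hβle, hval, hΛ⟩ := TowerE1.strong_root 1 hlam hlam_one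
  obtain ⟨hT2, hTle⟩ := TowerE1.femtoSteps_bounds 1 hlam hlam_half hΛ
  have hlow := HS lam hlam hle1 β hβ0.le hβle (femtoSteps 1 β 1) (by omega) hTle
  have hvpos : 0 < invRunningCoupling β 1 := by rw [hval]; positivity
  have hPw := HP 1 β hvpos (by rw [hΛ]; exact hleΛ)
  have hup := (abs_le.mp hPw).2
  linarith

/-! ## §3 TowerCauchyE1: the anchor-coupling guard `1 ≤ β₁` is load-bearing (modulo PolyDeepTraceLaw) -/

/-- **TowerCauchyE1 q without `1 ≤ β₁` is false, given PolyDeepTraceLaw p** (`0 ≤ q`, `0 ≤ p`, `p·q < 3` — the line's regime).  Hypothesis =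
the text of `Ideate2g2.PolyDeepTraceLaw p` verbatim; negated conclusion = the text of `Ideate2g2.TowerCauchyE1 q` with the binder `1 ≤ β₁ →`
deleted.  Witness: `s = 1`, `ε = (1 − r_𝔥(1))/4`; given the prover's `M, lam0` take `lam` small, the anchor exponent `n` of `anchor_geometry`
(`A = lam^{−q}`), `(L, b, k, j, L₁) = (M^{n+2}, M, n, n, M^{n+1})`, `β` the weak root on `L` (in the window; poly-deep since
`L^p ≤ (M²lam^{−q})^p ≤ 1/(4lam³) ≤ β`, so π gives `r_L ≤ r_𝔥(1) + ε`) and `β₁` the STRONG root on the anchor `L₁ ≤ M·lam^{−q}` of the same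
label value (`strong_side_ge_growing`: `r_{L₁} ≥ 1 − ε`); the two ratios differ by `≥ 2ε`. [folklore] -/
theorem towerCauchyE1_false_without_beta1GeOne_of_polyDeep {q p : ℝ} (hq : 0 ≤ q) (hp : 0 ≤ p) (hpq : p * q < 3)
    (hPD : ∀ s : ℝ, 0 < s → ∀ ε : ℝ, 0 < ε → ∃ Λstar : ℝ, 0 < Λstar ∧
      ∀ (L : ℕ) [NeZero L], ∀ β : ℝ, (L : ℝ) ^ p ≤ β → 0 < invRunningCoupling β L → luscherLambda β L ≤ Λstar →
        |traceRatio L β (femtoSteps s β L) - hTraceRatio s| ≤ ε) :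
    ¬ (∀ s : ℝ, 0 < s → ∀ ε : ℝ, 0 < ε → ∃ M : ℕ, 2 ≤ M ∧ ∃ lam0 : ℝ, 0 < lam0 ∧ ∀ lam : ℝ, 0 < lam → lam ≤ lam0 →
        ∀ (L : ℕ) [NeZero L], M ^ 2 ≤ L → ∀ β : ℝ, InFemtoWindow lam β L →
          ∀ (b k j : ℕ) [NeZero b], M ≤ b → b < M ^ 2 → b * M ^ (k + 1) ≤ L → L < b * M ^ k * (M + 1) → j ≤ k →
            ∀ (L₁ : ℕ) [NeZero L₁], L₁ = b * M ^ j → lam ^ (-q) ≤ (L₁ : ℝ) →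
              ∀ β₁ : ℝ, invRunningCoupling β₁ L₁ = invRunningCoupling β L →
                |traceRatio L β (femtoSteps s β L) - traceRatio L₁ β₁ (femtoSteps s β₁ L₁)| ≤ ε) := by
  intro h
  have hr1 : hTraceRatio 1 < 1 := hTraceRatio_lt_one one_pos
  obtain ⟨g, hg⟩ : ∃ g : ℝ, g = 1 - hTraceRatio 1 := ⟨_, rfl⟩
  have hg0 : 0 < g := by rw [hg]; linarith
  obtain ⟨M, hM, lam0, hlam0, H⟩ := h 1 one_pos (g / 4) (by positivity)
  obtain ⟨Λstar, hΛstar, HP⟩ := hPD 1 one_pos (g / 4) (by positivity)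
  have hMR : (2 : ℝ) ≤ (M : ℝ) := by exact_mod_cast hM
  have hM2 : (1 : ℝ) ≤ (M : ℝ) ^ 2 := by nlinarith
  obtain ⟨lam1, hlam1, hlam1q, HS⟩ := strong_side_ge_growing (q := q) hM2 hg0
  obtain ⟨lamA, hlamA, HA⟩ := anchor_threshold hpq hM2
  obtain ⟨lam, hlam, hle0, hleΛ, hle1, hleA⟩ :
      ∃ lam : ℝ, 0 < lam ∧ lam ≤ lam0 ∧ lam ≤ Λstar ∧ lam ≤ lam1 ∧ lam ≤ lamA :=
    ⟨min (min lam0 Λstar) (min lam1 lamA), lt_min (lt_min hlam0 hΛstar) (lt_min hlam1 hlamA),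
      (min_le_left _ _).trans (min_le_left _ _), (min_le_left _ _).trans (min_le_right _ _),
      (min_le_right _ _).trans (min_le_left _ _), (min_le_right _ _).trans (min_le_right _ _)⟩
  have hlam_half : lam ≤ 1 / 2 := by linarith [hle1.trans hlam1q]
  have hlam_one : lam ≤ 1 := by linarith
  -- the anchor
  have hA1 : 1 ≤ lam ^ (-q) := Real.one_le_rpow_of_pos_of_le_one_of_nonpos hlam hlam_one (by linarith)
  obtain ⟨n, hAn, hL₁le, hLle, hML, c1, c2, c3, c4, hL₁eq⟩ := anchor_geometry M hM hA1
  haveI : NeZero M := ⟨by omega⟩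
  haveI : NeZero (M ^ (n + 1)) := ⟨pow_ne_zero _ (by omega)⟩
  haveI : NeZero (M ^ (n + 2)) := ⟨pow_ne_zero _ (by omega)⟩
  have hN₁ : ((M ^ (n + 1) : ℕ) : ℝ) ≤ (M : ℝ) ^ 2 * lam ^ (-q) :=
    hL₁le.trans (mul_le_mul_of_nonneg_right (by nlinarith) (by positivity))
  -- couplings: weak (window) root on the fine lattice, STRONG root on the anchor, same label value `1/lam³`
  obtain ⟨β, hβ1, hval, hΛ, hW⟩ := TowerE1.weak_root (M ^ (n + 2)) hlam hlam_one
  obtain ⟨β₁, hβ₁0, -, hβ₁le, hval₁, hΛ₁⟩ := TowerE1.strong_root (M ^ (n + 1)) hlam hlam_one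
  have hmatch : invRunningCoupling β₁ (M ^ (n + 1)) = invRunningCoupling β (M ^ (n + 2)) := by rw [hval₁, hval]
  obtain ⟨hT2₁, hTle₁⟩ := TowerE1.femtoSteps_bounds (M ^ (n + 1)) hlam hlam_half hΛ₁
  -- strong side on the anchor
  have hlow := HS lam hlam hle1 (M ^ (n + 1)) hN₁ β₁ hβ₁0.le hβ₁le (femtoSteps 1 β₁ (M ^ (n + 1))) (by omega) hTle₁
  -- the poly-deep law on the fine lattice at the weak root (floor via the anchor threshold)
  have hfloor : (((M ^ (n + 2) : ℕ) : ℝ)) ^ p ≤ β := by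
    calc (((M ^ (n + 2) : ℕ) : ℝ)) ^ p ≤ ((M : ℝ) ^ 2 * lam ^ (-q)) ^ p := Real.rpow_le_rpow (by positivity) hLle hp
      _ ≤ 1 / (4 * lam ^ 3) := HA lam hlam hleA
      _ ≤ β := BOHandover.beta_ge_of_window hlam hW
  have hvpos : 0 < invRunningCoupling β (M ^ (n + 2)) := by rw [hval]; positivity
  have hPw := HP (M ^ (n + 2)) β hfloor hvpos (by rw [hΛ]; exact hleΛ)
  have hup := (abs_le.mp hPw).2
  -- the TowerCauchy instance
  have hH := H lam hlam hle0 (M ^ (n + 2)) hML β hW M n n c1 c2 c3 c4 le_rfl (M ^ (n + 1)) hL₁eq hAn β₁ hmatch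
  have h1 := (abs_le.mp hH).1
  linarith

/-! ## §4 TowerCauchyE1: the window guard `1 ≤ β` (fine lattice) is load-bearing (modulo PolyDeepTraceLaw) -/

/-- **TowerCauchyE1 q without the window's `1 ≤ β` is false, given PolyDeepTraceLaw p** (`0 ≤ q`, `0 ≤ p`, `p·q < 3`).  Negated conclusion = the
text of `Ideate2g2.TowerCauchyE1 q` with `InFemtoWindow lam β L` weakened to its two `Λ`-inequalities `lam ≤ Λ(β,L) ≤ 2lam` (the guard `1 ≤ β₁`
KEPT).  Witness: as in §3 but with the STRONG root on the fine lattice `L = M^{n+2} ≤ M²·lam^{−q}` (`strong_side_ge_growing`: `r_L ≥ 1 − ε`) and the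
weak window root `β₁ ≥ 1` on the anchor `L₁ = M^{n+1}`, which is poly-deep (`L₁^p ≤ (M²lam^{−q})^p ≤ 1/(4lam³) ≤ β₁`), so π gives
`r_{L₁} ≤ r_𝔥(1) + ε`. [folklore] -/
theorem towerCauchyE1_false_without_windowBetaGeOne_of_polyDeep {q p : ℝ} (hq : 0 ≤ q) (hp : 0 ≤ p) (hpq : p * q < 3)
    (hPD : ∀ s : ℝ, 0 < s → ∀ ε : ℝ, 0 < ε → ∃ Λstar : ℝ, 0 < Λstar ∧
      ∀ (L : ℕ) [NeZero L], ∀ β : ℝ, (L : ℝ) ^ p ≤ β → 0 < invRunningCoupling β L → luscherLambda β L ≤ Λstar →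
        |traceRatio L β (femtoSteps s β L) - hTraceRatio s| ≤ ε) :
    ¬ (∀ s : ℝ, 0 < s → ∀ ε : ℝ, 0 < ε → ∃ M : ℕ, 2 ≤ M ∧ ∃ lam0 : ℝ, 0 < lam0 ∧ ∀ lam : ℝ, 0 < lam → lam ≤ lam0 →
        ∀ (L : ℕ) [NeZero L], M ^ 2 ≤ L → ∀ β : ℝ, lam ≤ luscherLambda β L → luscherLambda β L ≤ 2 * lam →
          ∀ (b k j : ℕ) [NeZero b], M ≤ b → b < M ^ 2 → b * M ^ (k + 1) ≤ L → L < b * M ^ k * (M + 1) → j ≤ k →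
            ∀ (L₁ : ℕ) [NeZero L₁], L₁ = b * M ^ j → lam ^ (-q) ≤ (L₁ : ℝ) →
              ∀ β₁ : ℝ, 1 ≤ β₁ → invRunningCoupling β₁ L₁ = invRunningCoupling β L →
                |traceRatio L β (femtoSteps s β L) - traceRatio L₁ β₁ (femtoSteps s β₁ L₁)| ≤ ε) := by
  intro h
  have hr1 : hTraceRatio 1 < 1 := hTraceRatio_lt_one one_pos
  obtain ⟨g, hg⟩ : ∃ g : ℝ, g = 1 - hTraceRatio 1 := ⟨_, rfl⟩
  have hg0 : 0 < g := by rw [hg]; linarith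
  obtain ⟨M, hM, lam0, hlam0, H⟩ := h 1 one_pos (g / 4) (by positivity)
  obtain ⟨Λstar, hΛstar, HP⟩ := hPD 1 one_pos (g / 4) (by positivity)
  have hMR : (2 : ℝ) ≤ (M : ℝ) := by exact_mod_cast hM
  have hM2 : (1 : ℝ) ≤ (M : ℝ) ^ 2 := by nlinarith
  obtain ⟨lam1, hlam1, hlam1q, HS⟩ := strong_side_ge_growing (q := q) hM2 hg0
  obtain ⟨lamA, hlamA, HA⟩ := anchor_threshold hpq hM2
  obtain ⟨lam, hlam, hle0, hleΛ, hle1, hleA⟩ :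
      ∃ lam : ℝ, 0 < lam ∧ lam ≤ lam0 ∧ lam ≤ Λstar ∧ lam ≤ lam1 ∧ lam ≤ lamA :=
    ⟨min (min lam0 Λstar) (min lam1 lamA), lt_min (lt_min hlam0 hΛstar) (lt_min hlam1 hlamA),
      (min_le_left _ _).trans (min_le_left _ _), (min_le_left _ _).trans (min_le_right _ _),
      (min_le_right _ _).trans (min_le_left _ _), (min_le_right _ _).trans (min_le_right _ _)⟩
  have hlam_half : lam ≤ 1 / 2 := by linarith [hle1.trans hlam1q]
  have hlam_one : lam ≤ 1 := by linarith
  -- the anchor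
  have hA1 : 1 ≤ lam ^ (-q) := Real.one_le_rpow_of_pos_of_le_one_of_nonpos hlam hlam_one (by linarith)
  obtain ⟨n, hAn, hL₁le, hLle, hML, c1, c2, c3, c4, hL₁eq⟩ := anchor_geometry M hM hA1
  haveI : NeZero M := ⟨by omega⟩
  haveI : NeZero (M ^ (n + 1)) := ⟨pow_ne_zero _ (by omega)⟩
  haveI : NeZero (M ^ (n + 2)) := ⟨pow_ne_zero _ (by omega)⟩
  have hN₁ : ((M ^ (n + 1) : ℕ) : ℝ) ≤ (M : ℝ) ^ 2 * lam ^ (-q) :=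
    hL₁le.trans (mul_le_mul_of_nonneg_right (by nlinarith) (by positivity))
  -- couplings: STRONG root on the fine lattice, weak (window) root on the anchor, same label value `1/lam³`
  obtain ⟨β, hβ0, -, hβle, hval, hΛ⟩ := TowerE1.strong_root (M ^ (n + 2)) hlam hlam_one
  obtain ⟨β₁, hβ₁1, hval₁, hΛ₁, hW₁⟩ := TowerE1.weak_root (M ^ (n + 1)) hlam hlam_one
  have hmatch : invRunningCoupling β₁ (M ^ (n + 1)) = invRunningCoupling β (M ^ (n + 2)) := by rw [hval₁, hval]
  obtain ⟨hT2, hTle⟩ := TowerE1.femtoSteps_bounds (M ^ (n + 2)) hlam hlam_half hΛ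
  -- strong side on the fine lattice
  have hlow := HS lam hlam hle1 (M ^ (n + 2)) hLle β hβ0.le hβle (femtoSteps 1 β (M ^ (n + 2))) (by omega) hTle
  -- the poly-deep law on the anchor at the weak root
  have hfloor : (((M ^ (n + 1) : ℕ) : ℝ)) ^ p ≤ β₁ := by
    calc (((M ^ (n + 1) : ℕ) : ℝ)) ^ p ≤ ((M : ℝ) ^ 2 * lam ^ (-q)) ^ p := Real.rpow_le_rpow (by positivity) hN₁ hp
      _ ≤ 1 / (4 * lam ^ 3) := HA lam hlam hleA
      _ ≤ β₁ := BOHandover.beta_ge_of_window hlam hW₁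
  have hvpos : 0 < invRunningCoupling β₁ (M ^ (n + 1)) := by rw [hval₁]; positivity
  have hPw := HP (M ^ (n + 1)) β₁ hfloor hvpos (by rw [hΛ₁]; exact hleΛ)
  have hup := (abs_le.mp hPw).2
  -- the TowerCauchy instance
  have hH := H lam hlam hle0 (M ^ (n + 2)) hML β (by rw [hΛ]) (by rw [hΛ]; linarith) M n n c1 c2 c3 c4 le_rfl
    (M ^ (n + 1)) hL₁eq hAn β₁ hβ₁1 hmatch
  have h1 := (abs_le.mp hH).2
  linarith

end R7

end Summit.QuantumFields.YangMills.Theorems.TwistedTraceScaling.Negative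

end
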